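import Summits.MatrixMultiplication.MatrixMultiplication.Theorems.SoloInformedCwTwoHallSix

/-!
# Door D7, exact half: the one-sided sharpenings ORIENT-HALL and HALF-ORIENT of HALL-6

`SoloInformedCwTwoHallSix` types HALL-6 (every binary word of a mixed system picks a representative, the letter
`s_k + d_k` being tradeable for `2 s_k` or `2 d_k`, all representatives in `[0, σ]` and pairwise distinct) and proves
HALL-6 ⟹ MIXED CLOSURE.  The seat's experiments (CLAIMS c151, c153, c156, c157; ≈ 10^6 designs, 0 failures) say
that much less freedom is needed: a **one-sided orientation** — one trade direction `o k` per pair, the same for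
every word — already admits distinct representatives (ORIENT-HALL), and in fact at least **half** of the `2^p`
orientations do (HALF-ORIENT; equality is attained at `p = 2, 3, 4`, and the single-pair 'pivot' strengthening is
false at `p = 3`).  No canonical orientation exists (every local rule tried fails on some design), so these are
existence statements.  This file types both conjectures and proves the chain

  HALF-ORIENT ⟹ ORIENT-HALL ⟹ HALL-6 ⟹ MIXED CLOSURE `4^p · 2^q ≤ σ + 1`.

Written by the solo-informed seat (gen 13); standard axioms only.
-/

namespace Summit.MatrixMultiplication.MatrixMultiplication.Theorems

open Finset

/-- A choice of representatives `ε` is **oriented by `o`** when every traded letter `s_k + d_k` is traded in the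
direction `o k` — to `2 d_k` if `o k = true`, to `2 s_k` if `o k = false` — uniformly over all words (untraded
letters keep the value `s_k + d_k`, choice code `1`). -/
def IsOriented {p q : ℕ} (o : Fin p → Bool) (ε : HWord p q → (Fin p → Fin 3)) : Prop :=
  ∀ m k, ε m k = 1 ∨ ε m k = (if o k then 2 else 0)

/-- HALL-6 realised by representatives oriented by `o`: the orientation `o` WORKS for the system `(s, d ; t)`. -/
def OrientedHallSix {p q : ℕ} (s d : Fin p → ℕ) (t : Fin q → ℕ) (o : Fin p → Bool) : Prop :=
  ∃ ε : HWord p q → (Fin p → Fin 3), IsOriented o ε ∧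
    (∀ m, candVal s d t m (ε m) ≤ mixedSigma s d t) ∧
    Function.Injective (fun m => candVal s d t m (ε m))

/-- A working orientation gives HALL-6 (forget the orientation). -/
theorem hallSix_of_orientedHallSix {p q : ℕ} (s d : Fin p → ℕ) (t : Fin q → ℕ) (o : Fin p → Bool)
    (h : OrientedHallSix s d t o) : HallSix s d t := by
  obtain ⟨ε, -, hle, hinj⟩ := h
  exact ⟨ε, hle, hinj⟩

/-- **ORIENT-HALL** (CLAIMS c151): every mixed design has a working one-sided orientation. -/
def OrientHallConjecture : Prop :=
  ∀ {p q : ℕ} (s d : Fin p → ℕ) (t : Fin q → ℕ), IsMixedDesign s d t → ∃ o, OrientedHallSix s d t o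

open Classical in
/-- The number of working orientations of the system `(s, d ; t)`. -/
noncomputable def workingOrientations {p q : ℕ} (s d : Fin p → ℕ) (t : Fin q → ℕ) : ℕ :=
  (Finset.univ.filter fun o : Fin p → Bool => OrientedHallSix s d t o).card

/-- **HALF-ORIENT** (CLAIMS c156): for every mixed design at least half of the `2^p` one-sided orientations work. -/
def HalfOrientConjecture : Prop :=
  ∀ {p q : ℕ} (s d : Fin p → ℕ) (t : Fin q → ℕ), IsMixedDesign s d t → 2 ^ p ≤ 2 * workingOrientations s d t

/-- HALF-ORIENT ⟹ ORIENT-HALL. -/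
theorem orientHallConjecture_of_halfOrientConjecture (h : HalfOrientConjecture) : OrientHallConjecture := by
  classical
  intro p q s d t hD
  have hle := h s d t hD
  have hpos : 0 < workingOrientations s d t := by
    have h1 : 1 ≤ 2 ^ p := Nat.one_le_two_pow
    omega
  obtain ⟨o, ho⟩ := Finset.card_pos.mp (by simpa [workingOrientations] using hpos)
  exact ⟨o, (Finset.mem_filter.mp ho).2⟩

/-- ORIENT-HALL ⟹ HALL-6 (as conjectures over all mixed designs). -/
theorem hallSixConjecture_of_orientHallConjecture (h : OrientHallConjecture) : HallSixConjecture := by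
  intro p q s d t hD
  obtain ⟨o, ho⟩ := h s d t hD
  exact hallSix_of_orientedHallSix s d t o ho

/-- HALF-ORIENT ⟹ MIXED CLOSURE `4^p · 2^q ≤ σ + 1` for every mixed design (through ORIENT-HALL and HALL-6). -/
theorem mixedClosure_of_halfOrientConjecture (h : HalfOrientConjecture) {p q : ℕ} (s d : Fin p → ℕ)
    (t : Fin q → ℕ) (hD : IsMixedDesign s d t) : 4 ^ p * 2 ^ q ≤ mixedSigma s d t + 1 :=
  mixedClosure_of_hallSixConjecture
    (hallSixConjecture_of_orientHallConjecture (orientHallConjecture_of_halfOrientConjecture h)) s d t hD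

end Summit.MatrixMultiplication.MatrixMultiplication.Theorems
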